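import Summits.FinalStateConjecture.FinalStateConjecture.Theorems.EIHFluxBalanceInertialRecessionStubEndgameOraclePairPieces

/-!
# Route EIHFluxBalance — crux `InertialRecession`, line `sublinear-is-free-clean-window-charges`:
# the increment oracle for a slow PAIR with ballistic outsiders — one ROUND of the compact phase

Helper file for the crux `stmt-FinalStateConjecture-10166`
(`Summit.FinalStateConjecture.FinalStateConjecture.Theses.EIHFluxBalance.InertialRecession`), registered stub `stub_incrementOracle`
(lead reshape r9/r10) of `Cruxes/InertialRecession/Lines/sublinear_is_free_clean_window_charges.lean`; lead's roadmap §9 (`|S| = 2`).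

`pair_round`: in the compact phase (`‖ξₗ − ξₖ‖ ≤ c₀s/2` on `[a,b]`) of a slow pair `{k,l}` with ballistic outsiders `O`, from any `u ∈ [a,b]`
there is `τ′ ∈ [u,b]` such that the pair's energy/momentum components change by at most `Y = X_c + 2X_p` on `[u,τ′]` and either `τ′ = b` or the
fuel `#{m ∈ O : x_m − 3d < 0}` has dropped: the pair window is used until the first bad time `τ = min_m inf BAD_m` (`tight_increment_mixed`),
then the two singleton windows until `τ′ = inf NEXT` (`singleton_increment_passage`, with the stretch length from `stretch_length_le` and the
frozen distance `≥ (7/8)d(τ)`); at `τ′ < b` all passage functions are `≥ 0` again and the outsider `m₀` whose passage began at `τ` has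
`x_{m₀} − 3d ≥ 0` for ever.
-/

noncomputable section

set_option linter.dupNamespace false

open Filter Topology Set MeasureTheory intervalIntegral
open scoped Topology BigOperators InnerProductSpace RealInnerProductSpace

namespace Summit.FinalStateConjecture.FinalStateConjecture.Theorems.SublinearIsFree.Oracle

open Literature.Geometry.Lorentzian
open Summit.FinalStateConjecture.FinalStateConjecture.Theorems.SublinearIsFree.Endgame

set_option maxHeartbeats 3200000 in
/-- **ONE ROUND OF THE COMPACT PHASE OF A SLOW PAIR.** See the module docstring. [folklore] -/
theorem pair_round {N : ℕ} (M : Fin N → ℝ) (ξ v : Fin N → ℝ → E3) (κ : ℝ) (P : ℝ → E3 → ℝ → Fin 4 → ℝ)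
    (ρ : ℝ → ℝ) (C T T' T₀ : ℝ) (ζ : ℝ → ℝ)
    (hWL : ∀ (t₁ t₂ : ℝ) (c : ℝ → E3) (R : ℝ → ℝ), T ≤ t₁ → t₁ ≤ t₂ →
      (∀ s ∈ Set.Icc t₁ t₂, ∀ s' ∈ Set.Icc t₁ t₂, ‖c s - c s'‖ ≤ 2 * |s - s'| ∧ |R s - R s'| ≤ 2 * |s - s'|) →
      (∀ s ∈ Set.Icc t₁ t₂, ρ s ≤ (1 / 2) * R s ∧ ‖c s‖ + R s ≤ (κ + κ ^ 2) / 2 * s ∧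
        ∀ j, ‖ξ j s - c s‖ ≤ (1 - 1 / 2) * R s ∨ (1 + 1 / 2) * R s ≤ ‖ξ j s - c s‖) →
      ∀ μ : Fin 4, |P t₂ (c t₂) (R t₂) μ - P t₁ (c t₁) (R t₁) μ| ≤ C * ∫ s in t₁..t₂, (R s ^ (3 / 2 : ℝ))⁻¹)
    (hID : ∀ (t : ℝ) (c : E3) (R : ℝ) (A : Finset (Fin N)), T' ≤ t → ρ t ≤ (1 / 2) * R →
      ‖c‖ + R ≤ (κ + κ ^ 2) / 2 * t →
      (∀ j, ‖ξ j t - c‖ ≤ (1 - 1 / 2) * R ∨ (1 + 1 / 2) * R ≤ ‖ξ j t - c‖) →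
      (∀ j, j ∈ A ↔ ‖ξ j t - c‖ ≤ (1 - 1 / 2) * R) →
      |P t c R 0 - ∑ j ∈ A, M j * (√(1 - ‖v j t‖ ^ 2))⁻¹| ≤ ζ t ∧
      ∀ k : Fin 3, |P t c R k.succ - ∑ j ∈ A, M j * (√(1 - ‖v j t‖ ^ 2))⁻¹ * v j t k| ≤ ζ t)
    (hC : 0 ≤ C) (hκ0 : 0 < κ) (hκ1 : κ < 1)
    (hξ : ∀ i, ContDiff ℝ 1 (ξ i)) (hspeed1 : ∀ i s, T₀ ≤ s → ‖deriv (ξ i) s‖ ≤ 1)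
    {k l : Fin N} (hkl : k ≠ l)
    {a b W A₀ σ ζstar : ℝ} (hT : T ≤ a) (hT' : T' ≤ a) (hT₀ : T₀ ≤ a) (ha : 0 < a)
    (hW : 0 < W) (hA₀ : 0 < A₀) (hσ0 : 0 ≤ σ) (hσ1 : 78 * σ ≤ W) (hσ2 : 120 * (Finset.univ \ {k, l} : Finset (Fin N)).card * σ ≤ W)
    (hcone : ∀ i, ∀ s ∈ Set.Icc a b, ‖ξ i s‖ ≤ κ ^ 2 * s)
    (n : Fin N → Fin N → E3) (hn : ∀ i ∈ ({k, l} : Finset (Fin N)), ∀ m ∈ Finset.univ \ {k, l}, ‖n i m‖ = 1)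
    (hball : ∀ i ∈ ({k, l} : Finset (Fin N)), ∀ m ∈ Finset.univ \ {k, l}, ∀ s ∈ Icc a b,
      W / 2 ≤ ⟪deriv (ξ m) s - deriv (ξ i) s, n i m⟫)
    (hfar : ∀ i j, i ≠ j → ∀ s ∈ Icc a b, A₀ ≤ ‖ξ i s - ξ j s‖)
    (hslow : ∀ s ∈ Icc a b, ∀ s' ∈ Icc a b, s ≤ s' → |‖ξ l s' - ξ k s'‖ - ‖ξ l s - ξ k s‖| ≤ σ * (s' - s))
    (hβ : ∀ s ∈ Icc a b, ‖ξ l s - ξ k s‖ ≤ (κ - κ ^ 2) / 2 * s / 2)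
    (hρ : ∀ s ∈ Set.Icc a b, (∀ i j, i ≠ j → ρ s ≤ ‖ξ i s - ξ j s‖ / 3) ∧ ρ s ≤ (κ - κ ^ 2) / 2 * s / 2)
    (hζ : ∀ s ∈ Set.Icc a b, ζ s ≤ ζstar) (hζ0 : ∀ s ∈ Set.Icc a b, 0 ≤ ζ s)
    {u : ℝ} (hu : u ∈ Set.Icc a b) :
    ∃ τ' ∈ Set.Icc u b,
      (|∑ j ∈ ({k, l} : Finset (Fin N)), M j * (√(1 - ‖v j τ'‖ ^ 2))⁻¹ - ∑ j ∈ ({k, l} : Finset (Fin N)), M j * (√(1 - ‖v j u‖ ^ 2))⁻¹| ≤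
          3 * (C * (2 * (((κ - κ ^ 2) / 2) ^ (3 / 2 : ℝ))⁻¹ * (a ^ (1 / 2 : ℝ))⁻¹ +
            (Finset.univ \ {k, l} : Finset (Fin N)).card * (2 * (2 * √2 * (8 / (W * √A₀)))) +
            2 * (19 * (Finset.univ \ {k, l} : Finset (Fin N)).card / (W * √A₀))) + 2 * ζstar) ∧
        ∀ kk : Fin 3, |∑ j ∈ ({k, l} : Finset (Fin N)), M j * (√(1 - ‖v j τ'‖ ^ 2))⁻¹ * v j τ' kk -
            ∑ j ∈ ({k, l} : Finset (Fin N)), M j * (√(1 - ‖v j u‖ ^ 2))⁻¹ * v j u kk| ≤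
          3 * (C * (2 * (((κ - κ ^ 2) / 2) ^ (3 / 2 : ℝ))⁻¹ * (a ^ (1 / 2 : ℝ))⁻¹ +
            (Finset.univ \ {k, l} : Finset (Fin N)).card * (2 * (2 * √2 * (8 / (W * √A₀)))) +
            2 * (19 * (Finset.univ \ {k, l} : Finset (Fin N)).card / (W * √A₀))) + 2 * ζstar)) ∧
      (τ' = b ∨
        ((Finset.univ \ {k, l} : Finset (Fin N)).filter fun m ↦
            ⟪ξ m τ' - ξ k τ', n k m⟫ - 3 * ‖ξ l τ' - ξ k τ'‖ < 0).card + 1 ≤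
         ((Finset.univ \ {k, l} : Finset (Fin N)).filter fun m ↦
            ⟪ξ m u - ξ k u, n k m⟫ - 3 * ‖ξ l u - ξ k u‖ < 0).card) := by
  classical
  -- constants and notation
  set c₀ : ℝ := (κ - κ ^ 2) / 2 with hc₀def
  have hκκ : 0 < κ - κ ^ 2 := by nlinarith
  have hc₀ : 0 < c₀ := by positivity
  set O : Finset (Fin N) := Finset.univ \ {k, l} with hOdef
  have hmemO : ∀ m, m ∈ O ↔ m ≠ k ∧ m ≠ l := fun m ↦ by simp [hOdef]
  set X : ℝ := C * (2 * (c₀ ^ (3 / 2 : ℝ))⁻¹ * (a ^ (1 / 2 : ℝ))⁻¹ + O.card * (2 * (2 * √2 * (8 / (W * √A₀)))) +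
      2 * (19 * O.card / (W * √A₀))) + 2 * ζstar with hX
  set d : ℝ → ℝ := fun s ↦ ‖ξ l s - ξ k s‖ with hd
  set x : Fin N → ℝ → ℝ := fun m s ↦ ⟪ξ m s - ξ k s, n k m⟫ with hx
  set f : Fin N → ℝ → ℝ := fun m s ↦ |x m s| - 3 * d s with hf
  set g : Fin N → ℝ → ℝ := fun m s ↦ x m s - 3 * d s with hg
  set E : ℝ → ℝ := fun s ↦ ∑ j ∈ ({k, l} : Finset (Fin N)), M j * (√(1 - ‖v j s‖ ^ 2))⁻¹ with hE
  set Pk : Fin 3 → ℝ → ℝ := fun kk s ↦ ∑ j ∈ ({k, l} : Finset (Fin N)), M j * (√(1 - ‖v j s‖ ^ 2))⁻¹ * v j s kk with hPk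
  have hkmem : k ∈ ({k, l} : Finset (Fin N)) := by simp
  have hlmem : l ∈ ({k, l} : Finset (Fin N)) := by simp
  have hub : u ≤ b := hu.2
  have hsubu : ∀ s ∈ Set.Icc u b, s ∈ Set.Icc a b := fun s hs ↦ ⟨hu.1.trans hs.1, hs.2⟩
  -- basic positivity / sizes
  have hW6 : 6 * σ < W := by linarith
  have hdpos : ∀ s ∈ Set.Icc a b, 0 < d s := fun s hs ↦ hA₀.trans_le (hfar l k hkl.symm s hs)
  have hζ2 : ∀ s ∈ Set.Icc a b, ∀ s' ∈ Set.Icc a b, ζ s + ζ s' ≤ 2 * ζstar := fun s hs s' hs' ↦ by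
    linarith [hζ s hs, hζ s' hs']
  have hX0 : 0 ≤ X := by
    have h1 : 0 ≤ ζstar := (hζ0 a ⟨le_rfl, hu.1.trans hub⟩).trans (hζ a ⟨le_rfl, hu.1.trans hub⟩)
    positivity
  have ha_rpow : ∀ s, a ≤ s → (s ^ (1 / 2 : ℝ))⁻¹ ≤ (a ^ (1 / 2 : ℝ))⁻¹ := fun s hs ↦
    inv_anti₀ (Real.rpow_pos_of_pos ha _) (Real.rpow_le_rpow ha.le hs (by norm_num))
  -- proxies: gains, domination, continuity
  have hgain : ∀ m ∈ O, ∀ s ∈ Icc a b, ∀ s' ∈ Icc a b, s ≤ s' → W / 2 * (s' - s) ≤ x m s' - x m s :=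
    fun m hm ↦ proxy_gain (hξ k) (hξ m) (hball k hkmem m hm)
  have hxle : ∀ m ∈ O, ∀ s, |x m s| ≤ ‖ξ m s - ξ k s‖ := fun m hm s ↦ abs_proxy_le_dist (hn k hkmem m hm)
  have hfcont : ∀ m, Continuous (f m) := fun m ↦
    ((((hξ m).continuous.sub (hξ k).continuous).inner continuous_const).abs).sub
      (continuous_const.mul ((hξ l).continuous.sub (hξ k).continuous).norm)
  have hdslow : ∀ s ∈ Icc a b, ∀ s' ∈ Icc a b, s ≤ s' → |d s' - d s| ≤ σ * (s' - s) := hslow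
  -- `g m` is non-decreasing on `[a,b]`
  have hgmono : ∀ m ∈ O, ∀ s ∈ Icc a b, ∀ s' ∈ Icc a b, s ≤ s' → g m s ≤ g m s' := by
    intro m hm s hs s' hs' hss'
    have h1 := hgain m hm s hs s' hs' hss'
    have h2 := hdslow s hs s' hs' hss'
    rw [abs_le] at h2
    simp only [hg]
    nlinarith [h2.2, hss']
  -- `f m` decreases where `x m` stays negative: if `x m s' < 0`, `s ≤ s'`, then `f m s' ≤ f m s - (W/2 - 3σ)(s' - s)`
  have hfdec : ∀ m ∈ O, ∀ s ∈ Icc a b, ∀ s' ∈ Icc a b, s ≤ s' → x m s' < 0 → f m s' ≤ f m s := by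
    intro m hm s hs s' hs' hss' hneg
    have h1 := hgain m hm s hs s' hs' hss'
    have h2 := hdslow s hs s' hs' hss'
    rw [abs_le] at h2
    have hxs : x m s < 0 := by nlinarith [hss']
    simp only [hf]
    rw [abs_of_neg hneg, abs_of_neg hxs]
    nlinarith [h2.1, h2.2, hss']
  -- GOOD ⇒ the pair is tight relative to every outsider: `d ≤ ‖ξ m − ξ k‖ / 3`
  have htight_of_good : ∀ s, ∀ m ∈ O, 0 ≤ f m s → 3 * ‖ξ l s - ξ k s‖ ≤ ‖ξ m s - ξ k s‖ := by
    intro s m hm h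
    have := hxle m hm s
    simp only [hf, hd] at h
    linarith
  ---------------------------------------------------------------- the compact pair window on a GOOD interval
  have hpieces := pair_pieces M ξ v κ P ρ C T T' T₀ ζ hWL hID hC hκ0 hκ1 hξ hspeed1 hkl hT hT' hT₀ ha hW hA₀ hσ0 hσ2
    hcone n hn hball hfar hslow hβ hρ hζ
  have pairSeg : ∀ u₁ u₂, a ≤ u₁ → u₁ ≤ u₂ → u₂ ≤ b → O.Nonempty → (∀ s ∈ Set.Icc u₁ u₂, ∀ m ∈ O, 0 ≤ f m s) →
      |E u₂ - E u₁| ≤ X ∧ ∀ kk, |Pk kk u₂ - Pk kk u₁| ≤ X := by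
    intro u₁ u₂ h1 h12 h2b hOne hgood
    have h := hpieces.1 u₁ u₂ h1 h12 h2b hOne (fun s hs m hm ↦ htight_of_good s m hm (hgood s hs m hm))
    refine ⟨?_, fun kk ↦ ?_⟩
    · simpa only [hE, hX, hOdef, hc₀def] using h.1
    · simpa only [hPk, hX, hOdef, hc₀def] using h.2 kk
  have hpieces2 := hpieces.2
  clear hpieces
  have singSeg : ∀ u₁ u₂, a ≤ u₁ → u₁ ≤ u₂ → u₂ ≤ b → u₂ - u₁ ≤ 15 * O.card * d u₁ / W →
      |E u₂ - E u₁| ≤ 2 * X ∧ ∀ kk, |Pk kk u₂ - Pk kk u₁| ≤ 2 * X := by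
    intro u₁ u₂ h1 h12 h2b hlen
    have h := hpieces2 u₁ u₂ h1 h12 h2b (by simpa only [hd] using hlen)
    refine ⟨?_, fun kk ↦ ?_⟩
    · simpa only [hE, hX, hOdef, hc₀def] using h.1
    · simpa only [hPk, hX, hOdef, hc₀def] using h.2 kk
  clear hpieces2
  ---------------------------------------------------------------- the round
  -- bad sets of the outsiders after `u`
  set BAD : Fin N → Set ℝ := fun m ↦ {s | s ∈ Set.Icc u b ∧ |x m s| - 3 * d s < 0} with hBAD
  set Obad : Finset (Fin N) := O.filter fun m ↦ (BAD m).Nonempty with hObad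
  by_cases hObne : Obad = ∅
  · -- no passage at all after `u`: one pair segment up to `b` (or nothing to do if there is no outsider)
    have hgood : ∀ s ∈ Set.Icc u b, ∀ m ∈ O, 0 ≤ f m s := by
      intro s hs m hm
      by_contra h
      push Not at h
      have : m ∈ Obad := Finset.mem_filter.mpr ⟨hm, ⟨s, hs, by simpa [hf] using h⟩⟩
      rw [hObne] at this; simp at this
    refine ⟨b, ⟨hub, le_rfl⟩, ?_, Or.inl rfl⟩
    rcases O.eq_empty_or_nonempty with hO | hO
    · -- no outsiders: the pair window with `F = ∅`, `B = ∅` is still `tight_increment_mixed`… but `Sc` must be nonempty;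
      -- with no outsider the pair is the whole system: use the compact-univ lemma through `pairSeg` is impossible, so argue directly.
      have hSc : ¬ (Finset.univ \ ({k, l} : Finset (Fin N))).Nonempty := by rw [← hOdef, hO]; simp
      -- `{k,l} = univ`
      have huniv : ({k, l} : Finset (Fin N)) = Finset.univ := by
        have hE0 : Finset.univ \ ({k, l} : Finset (Fin N)) = ∅ := by rw [← hOdef, hO]
        refine Finset.eq_univ_of_forall fun i ↦ ?_
        by_contra hi
        have : i ∈ Finset.univ \ ({k, l} : Finset (Fin N)) := Finset.mem_sdiff.mpr ⟨Finset.mem_univ i, hi⟩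
        rw [hE0] at this
        simp at this
      have h := univ_increment M ξ v κ P ρ C T T' T₀ ζ hWL hID hC hκ0 hκ1
        (fun i ↦ (hξ i).differentiable one_ne_zero) (fun i s hs ↦ (hspeed1 i s hs).trans (by norm_num)) k
        (hT.trans hu.1) (hT'.trans hu.1) (hT₀.trans hu.1) (ha.trans_le hu.1) hub (fun s hs ↦ hcone k s (hsubu s hs))
        (fun s hs ↦ (hρ s (hsubu s hs)).2)
        (fun s hs i ↦ by
          rcases eq_or_ne i k with h | h
          · subst h; simp only [sub_self, norm_zero]
            exact (norm_nonneg (ξ l s - ξ i s)).trans (hβ s (hsubu s hs))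
          · have hil : i = l := by
              have : i ∈ ({k, l} : Finset (Fin N)) := huniv ▸ Finset.mem_univ i
              rcases Finset.mem_insert.mp this with h' | h'
              · exact absurd h' h
              · simpa using h'
            subst hil; exact hβ s (hsubu s hs))
      have hb' : C * (2 * (((κ - κ ^ 2) / 2) ^ (3 / 2 : ℝ))⁻¹ * (u ^ (1 / 2 : ℝ))⁻¹) + ζ u + ζ b ≤ X := by
        rw [hX, ← hc₀def]
        have h1' := ha_rpow u hu.1
        have h2 : C * (2 * (c₀ ^ (3 / 2 : ℝ))⁻¹ * (u ^ (1 / 2 : ℝ))⁻¹) ≤ C * (2 * (c₀ ^ (3 / 2 : ℝ))⁻¹ * (a ^ (1 / 2 : ℝ))⁻¹) :=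
          mul_le_mul_of_nonneg_left (mul_le_mul_of_nonneg_left h1' (by positivity)) hC
        have h3 : 0 ≤ C * (O.card * (2 * (2 * √2 * (8 / (W * √A₀)))) + 2 * (19 * O.card / (W * √A₀))) := by positivity
        have h4 := hζ2 u hu b ⟨hu.1.trans hub, le_rfl⟩
        nlinarith [h2, h3, h4]
      have hX3 : X ≤ 3 * X := by linarith
      refine ⟨?_, fun kk ↦ ?_⟩
      · rw [huniv]; exact (h.1.trans hb').trans hX3
      · rw [huniv]; exact ((h.2 kk).trans hb').trans hX3
    · have h := pairSeg u b hu.1 hub le_rfl hO hgood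
      have hX3 : X ≤ 3 * X := by linarith
      exact ⟨h.1.trans hX3, fun kk ↦ (h.2 kk).trans hX3⟩
  -- there is a passage after `u`
  have hObne' : Obad.Nonempty := Finset.nonempty_iff_ne_empty.mpr hObne
  obtain ⟨m₀, hm₀, hm₀min⟩ := Finset.exists_mem_eq_inf' hObne' (fun m ↦ sInf (BAD m))
  set τ : ℝ := Obad.inf' hObne' (fun m ↦ sInf (BAD m)) with hτdef
  have hm₀O : m₀ ∈ O := (Finset.mem_filter.mp hm₀).1
  have hBm₀ : (BAD m₀).Nonempty := (Finset.mem_filter.mp hm₀).2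
  have hOne : O.Nonempty := ⟨m₀, hm₀O⟩
  have hbddBAD : ∀ m, BddBelow (BAD m) := fun m ↦ ⟨u, fun s hs ↦ hs.1.1⟩
  obtain ⟨p₀, hp₀⟩ := hBm₀
  have hτp₀ : τ ≤ p₀ := by rw [hm₀min]; exact csInf_le (hbddBAD m₀) hp₀
  have huτ : u ≤ τ := by
    rw [hm₀min]; exact le_csInf ⟨p₀, hp₀⟩ fun s hs ↦ hs.1.1
  have hp₀b : p₀ ≤ b := hp₀.1.2
  have hτb : τ ≤ b := hτp₀.trans hp₀b
  have hτab : τ ∈ Set.Icc a b := ⟨hu.1.trans huτ, hτb⟩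
  -- GOOD strictly before `τ`
  have hgood_lt : ∀ s ∈ Set.Icc u b, s < τ → ∀ m ∈ O, 0 ≤ f m s := by
    intro s hs hsτ m hm
    by_contra h
    push Not at h
    have hsB : s ∈ BAD m := ⟨hs, by simpa [hf] using h⟩
    have hmO : m ∈ Obad := Finset.mem_filter.mpr ⟨hm, ⟨s, hsB⟩⟩
    have h1 : τ ≤ sInf (BAD m) := by rw [hτdef]; exact Finset.inf'_le _ hmO
    have h2 : sInf (BAD m) ≤ s := csInf_le (hbddBAD m) hsB
    linarith
  -- GOOD on `[u, τ]` when `u < τ`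
  have hgood_le : u < τ → ∀ s ∈ Set.Icc u τ, ∀ m ∈ O, 0 ≤ f m s := by
    intro huτ' s hs m hm
    rcases eq_or_lt_of_le hs.2 with heq | hlt
    · -- limit from the left at `τ`
      rw [heq]
      have hcw : ContinuousWithinAt (f m) (Set.Ico u τ) τ := (hfcont m).continuousAt.continuousWithinAt
      haveI : (𝓝[Set.Ico u τ] τ).NeBot := by
        apply mem_closure_iff_nhdsWithin_neBot.mp
        rw [closure_Ico huτ'.ne]; exact ⟨huτ'.le, le_rfl⟩
      have hev : ∀ᶠ y in 𝓝[Set.Ico u τ] τ, 0 ≤ f m y :=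
        eventually_nhdsWithin_of_forall fun y hy ↦ hgood_lt y ⟨hy.1, hy.2.le.trans hτb⟩ hy.2 m hm
      exact ge_of_tendsto hcw hev
    · exact hgood_lt s ⟨hs.1, hlt.le.trans hτb⟩ hlt m hm
  -- the pair segment `[u, τ]`
  have hseg1 : |E τ - E u| ≤ X ∧ ∀ kk, |Pk kk τ - Pk kk u| ≤ X := by
    rcases eq_or_lt_of_le huτ with heq | hlt
    · rw [← heq]; simp only [sub_self, abs_zero]; exact ⟨hX0, fun _ ↦ hX0⟩
    · exact pairSeg u τ hu.1 hlt.le hτb hOne (hgood_le hlt)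
  -- the passage of `m₀` covers `(τ, p₀]`
  have hOC : OrdConnected (BAD m₀) := by
    have := ordConnected_passageSet (x := x m₀) (d := d) (a := u) (b := b) hσ0 hW6
      (fun s hs s' hs' hss' ↦ hgain m₀ hm₀O s (hsubu s hs) s' (hsubu s' hs') hss')
      (fun s hs s' hs' hss' ↦ hdslow s (hsubu s hs) s' (hsubu s' hs') hss')
    simpa [hBAD] using this
  have hcoverm₀ : ∀ s, τ < s → s ≤ p₀ → s ∈ BAD m₀ := by
    intro s hτs hsp
    have hlt : sInf (BAD m₀) < s := by rw [← hm₀min]; exact hτs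
    obtain ⟨q, hq, hqs⟩ := exists_lt_of_csInf_lt ⟨p₀, hp₀⟩ hlt
    exact hOC.out hq hp₀ ⟨hqs.le, hsp⟩
  -- NEXT and `τ'`
  set NEXT : Set ℝ := {s | s ∈ Set.Icc p₀ b ∧ ∀ m ∈ O, 0 ≤ f m s} ∪ {b} with hNEXT
  have hNEXTclosed : IsClosed NEXT := by
    refine IsClosed.union ?_ isClosed_singleton
    have : {s | s ∈ Set.Icc p₀ b ∧ ∀ m ∈ O, 0 ≤ f m s} = Set.Icc p₀ b ∩ ⋂ m ∈ O, (f m) ⁻¹' Set.Ici 0 := by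
      ext s; simp [Set.mem_iInter]
    rw [this]
    exact isClosed_Icc.inter (isClosed_biInter fun m _ ↦ (isClosed_Ici.preimage (hfcont m)))
  have hbNEXT : b ∈ NEXT := Or.inr rfl
  have hNEXTbdd : BddBelow NEXT := ⟨p₀, fun s hs ↦ by
    rcases hs with h | h
    · exact h.1.1
    · rw [Set.mem_singleton_iff.mp h]; exact hp₀b⟩
  set τ' : ℝ := sInf NEXT with hτ'def
  have hτ'mem : τ' ∈ NEXT := hNEXTclosed.csInf_mem ⟨b, hbNEXT⟩ hNEXTbdd
  have hp₀τ' : p₀ ≤ τ' := le_csInf ⟨b, hbNEXT⟩ fun s hs ↦ by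
    rcases hs with h | h
    · exact h.1.1
    · rw [Set.mem_singleton_iff.mp h]; exact hp₀b
  have hτ'b : τ' ≤ b := csInf_le hNEXTbdd hbNEXT
  have hττ' : τ ≤ τ' := hτp₀.trans hp₀τ'
  have hτ'ab : τ' ∈ Set.Icc a b := ⟨hτab.1.trans hττ', hτ'b⟩
  -- `(τ, τ')` is bad
  have hbad : ∀ s, τ < s → s < τ' → ∃ m ∈ O, |x m s| < 3 * d s := by
    intro s hτs hsτ'
    rcases le_or_gt s p₀ with hsp | hsp
    · exact ⟨m₀, hm₀O, by have := (hcoverm₀ s hτs hsp).2; linarith⟩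
    · by_contra h
      push Not at h
      have hsN : s ∈ NEXT := Or.inl ⟨⟨hsp.le, hsτ'.le.trans hτ'b⟩, fun m hm ↦ by have := h m hm; simp only [hf]; linarith⟩
      have := csInf_le hNEXTbdd hsN
      linarith
  -- the stretch is short
  have hlen : τ' - τ ≤ 15 * O.card * d τ / W := by
    refine stretch_length_le O x d (a := a) (b := b) hW hσ0 hσ1 (by simpa [hOdef] using hσ2) hτab.1 hτ'b (hdpos τ hτab)
      hgain hdslow ?_
    intro s hs
    obtain ⟨m, hm, hsm⟩ := hbad s hs.1 hs.2
    exact Set.mem_iUnion₂.mpr ⟨m, hm, ⟨⟨hτab.1.trans hs.1.le, hs.2.le.trans hτ'b⟩, hsm⟩⟩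
  have hseg2 := singSeg τ τ' hτab.1 hττ' hτ'b hlen
  -- the increment over the round
  have hround : |E τ' - E u| ≤ 3 * X ∧ ∀ kk, |Pk kk τ' - Pk kk u| ≤ 3 * X := by
    refine ⟨?_, fun kk ↦ ?_⟩
    · calc |E τ' - E u| = |(E τ' - E τ) + (E τ - E u)| := by ring_nf
        _ ≤ |E τ' - E τ| + |E τ - E u| := abs_add_le _ _
        _ ≤ 2 * X + X := add_le_add hseg2.1 hseg1.1
        _ = 3 * X := by ring
    · calc |Pk kk τ' - Pk kk u| = |(Pk kk τ' - Pk kk τ) + (Pk kk τ - Pk kk u)| := by ring_nf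
        _ ≤ |Pk kk τ' - Pk kk τ| + |Pk kk τ - Pk kk u| := abs_add_le _ _
        _ ≤ 2 * X + X := add_le_add (hseg2.2 kk) (hseg1.2 kk)
        _ = 3 * X := by ring
  refine ⟨τ', ⟨huτ.trans hττ', hτ'b⟩, ⟨?_, fun kk ↦ ?_⟩, ?_⟩
  · simpa only [hE, hX] using hround.1
  · simpa only [hPk, hX] using hround.2 kk
  -- the fuel
  rcases hτ'mem with hτ'N | hτ'N
  swap
  · exact Or.inl (Set.mem_singleton_iff.mp hτ'N)
  right
  -- `m₀` is counted at `u` but not at `τ'`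
  have hgu : g m₀ u < 0 := by
    have h1 : g m₀ u ≤ g m₀ p₀ := hgmono m₀ hm₀O u hu p₀ (hsubu p₀ hp₀.1) hp₀.1.1
    have h2 : g m₀ p₀ ≤ f m₀ p₀ := by simp only [hg, hf]; linarith [le_abs_self (x m₀ p₀)]
    have h3 : f m₀ p₀ < 0 := by simpa [hf] using hp₀.2
    linarith
  have hgτ' : 0 ≤ g m₀ τ' := by
    have hfτ' : 0 ≤ f m₀ τ' := hτ'N.2 m₀ hm₀O
    by_cases hxτ' : 0 ≤ x m₀ τ'
    · simp only [hg]; simp only [hf, abs_of_nonneg hxτ'] at hfτ'; exact hfτ'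
    · push Not at hxτ'
      have h1 := hfdec m₀ hm₀O p₀ (hsubu p₀ hp₀.1) τ' hτ'ab hp₀τ' hxτ'
      have h3 : f m₀ p₀ < 0 := by simpa [hf] using hp₀.2
      linarith
  have hsubFU : (O.filter fun m ↦ g m τ' < 0) ⊆ O.filter fun m ↦ g m u < 0 := by
    intro m hm
    rw [Finset.mem_filter] at hm ⊢
    exact ⟨hm.1, lt_of_le_of_lt (hgmono m hm.1 u hu τ' hτ'ab (huτ.trans hττ')) hm.2⟩
  have hm₀u : m₀ ∈ O.filter fun m ↦ g m u < 0 := Finset.mem_filter.mpr ⟨hm₀O, hgu⟩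
  have hm₀τ' : m₀ ∉ O.filter fun m ↦ g m τ' < 0 := fun h ↦ by
    have := (Finset.mem_filter.mp h).2; linarith
  have hss : (O.filter fun m ↦ g m τ' < 0) ⊂ O.filter fun m ↦ g m u < 0 :=
    Finset.ssubset_iff_of_subset hsubFU |>.mpr ⟨m₀, hm₀u, hm₀τ'⟩
  have := Finset.card_lt_card hss
  simp only [hg, hx, hd] at this
  simpa [hOdef] using Nat.succ_le_of_lt this

/-- Registered helper form: the fuel filter is monotone under a non-decreasing `g` (carrier of this file). [folklore] -/
theorem oracle_fuel_filter_subset : ∀ (N : ℕ) (k l : Fin N) (O : Finset (Fin N)) (g : Fin N → ℝ → ℝ) (u τ' : ℝ), (∀ m ∈ O, g m u ≤ g m τ') → (O.filter fun m ↦ g m τ' < 0) ⊆ O.filter fun m ↦ g m u < 0 := by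
  intro N k l O g u τ' hmono m hm
  rw [Finset.mem_filter] at hm ⊢
  exact ⟨hm.1, lt_of_le_of_lt (hmono m hm.1) hm.2⟩

end Summit.FinalStateConjecture.FinalStateConjecture.Theorems.SublinearIsFree.Oracle

end
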